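import Mathlib
import Literature.AlgebraicGeometry.Resolution.PointBlowupFlagShiftBound
import Summits.ResolutionOfSingularities.ResolutionOfSingularities.Theorems.WeightedInvariantLocalWeightedDropWildPurePowerFlagTangent
import Summits.ResolutionOfSingularities.ResolutionOfSingularities.Theorems.WeightedInvariantLocalWeightedDropWildPurePowerFlagStatements

/-!
# `WeightedInvariant.LocalWeightedDrop`, line `hasse-ridge-face-selection`, piece S3πM: the two presentations of a transversal flag
# (`n = 1`) have the same triple

Crux item stmt-ResolutionOfSingularities-8899 `LocalWeightedDrop` (route `ResolutionOfSingularities/WeightedInvariant`), serving the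
door `WeightedConstruction` stmt-ResolutionOfSingularities-0571.  [OURS · L1 W4.3, chain w43, stub worker 1 (gen 3).  Not a statement of any
manuscript.  In H. Hauser, S. Perlega, PRIMS **60** (2024) the flag invariant is attached to the FLAG and "does not depend on the choice
of a regular system of parameters subordinate to 𝓕" ([Per17, Prop. 4.1.5], quoted p. 784); the game-side invariant `PurePowerFlag` is
coordinate-bound, and this file proves the one instance of that independence the descent needs.]

When both coordinate lines are exceptional, a curve through the point transversal to both (`n_𝓕 = 1`) is a flag in BOTH orientations:
`V(y − h(x))` (datum `(false, h)`, `ord h = 1`) and `V(x − g(y))` (datum `(true, g)`), with inverse slopes `h₁ g₁ = 1`.  We show the two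
data have the same triple (`flagTriple_swap_of_tangency_one`):
* for tangency `1` (weights `(1,1)`) only the LINEAR part of the shift enters: the weighted initial form of the cleaned expansion is
  the cleaning of the degree-`m` form of `C` under the linear part of the change (`dcurv_one_congr`, from res-lit-5's
  `coeff_subst_triangular_of_weight_le`);
* for the linear shifts `h₁·X`, `g₁·X` the two expansions differ by the LINEAR change `τ : (x, y) ↦ (y + g₁x, −h₁y)`
  (`subst_tau_shear_eq`); below the `y`-order `j₀` of the cleaned degree-`m` form of the first, every degree-`m` monomial is in `q·ℕ²`,
  hence maps under `τ` to a `q`-th power (supported on `q·ℕ²`), while the rest maps into `(y^{j₀})`; so the cleaned degree-`m` form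
  of the second has `y`-order `≥ j₀` (`dcurv_one_le_swap`), and by symmetry the `y`-orders agree.
-/

set_option linter.dupNamespace false -- mandated namespace of this single-conjunct summit

namespace Summit.ResolutionOfSingularities.ResolutionOfSingularities.Theorems

open Literature.AlgebraicGeometry.Resolution
open Literature.AlgebraicGeometry.Resolution.HauserPerlega2024

namespace PurePowerFlag

open MvPowerSeries

variable {k : Type} [Field k]

/-! ### Tangency one: the degree-`m` layer of the expansion -/

/-- The weight `(1,1)` is the degree. -/
theorem weight_weights_one (d : Fin 2 →₀ ℕ) : Finsupp.weight (weights 1) d = d 0 + d 1 := by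
  rw [weight_weights, one_mul]

/-- The flattened degree-`m` form of `C`: `P(Y) = Σ_{b ≤ m} [x^{m−b} y^b]C · Y^b`. -/
noncomputable def degForm (C : MvPowerSeries (Fin 2) k) (m : ℕ) : Polynomial k :=
  ∑ b ∈ Finset.range (m + 1), Polynomial.monomial b (coeff (Finsupp.single 0 (m - b) + Finsupp.single 1 b) C)

/-- THE DEGREE-`m` LAYER OF A SHIFTED SERIES (`m = ord C`): below degree `m` nothing; in degree `m`, the Taylor shift by the linear
coefficient `t = [X]φ` of the flattened degree-`m` form. [HP24 Lemma 2 proof p. 789 l. 40 – p. 790 l. 2 ("F = in_ω(F)(x, y₁ − t xⁿ) + K")] -/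
theorem coeff_subst_shift_of_degree_le {C : MvPowerSeries (Fin 2) k} (φ : PowerSeries k)
    (h0 : PowerSeries.constantCoeff φ = 0) (d : Fin 2 →₀ ℕ) (hd : d 0 + d 1 ≤ C.order.toNat) :
    coeff d (subst (shift φ) C) =
      if d 0 + d 1 = C.order.toNat then (Polynomial.taylor (PowerSeries.coeff 1 φ) (degForm C C.order.toNat)).coeff (d 1)
      else 0 := by
  set m := C.order.toNat with hm
  have hlt : ∀ m', m' < 1 → PowerSeries.coeff m' φ = 0 := fun m' hm' => by
    have : m' = 0 := by omega
    rw [this, PowerSeries.coeff_zero_eq_constantCoeff, h0]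
  have hw : ∀ d : Fin 2 →₀ ℕ, coeff d C ≠ 0 → m ≤ d 0 + 1 * d 1 := fun d hd => by
    rw [one_mul]; exact order_toNat_le_degree hd
  have key := coeff_subst_triangular_of_weight_le (0 : Fin 2) 1 (by decide) letter_cases Nat.zero_lt_one hlt rfl C hw d
    (by rw [one_mul]; exact hd)
  rw [shift_eq]
  rw [key]
  simp only [one_mul, Nat.div_one]
  rfl

/-- For tangency `1` the weighted order of the expansion is the order of `C`. -/
theorem wFlag_one_eq (p : ℕ) [Fact p.Prime] [CharP k p] (e : ℕ) {C : MvPowerSeries (Fin 2) k} (hC : C ≠ 0)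
    (hclean : cleanSeries (p ^ e) C = C) (φ : PowerSeries k) (h0 : PowerSeries.constantCoeff φ = 0) :
    wFlag (p ^ e) C φ 1 = (C.order.toNat : ℕ∞) := by
  classical
  unfold wFlag
  apply le_antisymm
  · obtain ⟨d, hd, hdeg⟩ := exists_coeff_expansion_degree_eq p e hC hclean φ h0
    have := weightedOrder_le (weights 1) hd
    rwa [weight_weights_one, hdeg] at this
  · refine le_weightedOrder (weights 1) fun d hd => ?_
    rw [weight_weights_one] at hd
    have hd' : d 0 + d 1 < C.order.toNat := by exact_mod_cast hd
    rw [expansion, coeff_cleanSeries]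
    split_ifs
    · rfl
    · rw [coeff_subst_shift_of_degree_le φ h0 d hd'.le, if_neg hd'.ne]

open Classical in
/-- THE INITIAL FORM FOR TANGENCY `1`: a monomial lies in the weighted initial part of the expansion iff it has degree `m = ord C`, is
not in `q·ℕ²`, and its Taylor coefficient is non-zero. -/
theorem coeff_initialPart_expansion_one_ne_zero_iff (p : ℕ) [Fact p.Prime] [CharP k p] (e : ℕ) {C : MvPowerSeries (Fin 2) k}
    (hC : C ≠ 0) (hclean : cleanSeries (p ^ e) C = C) (φ : PowerSeries k) (h0 : PowerSeries.constantCoeff φ = 0)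
    (d : Fin 2 →₀ ℕ) :
    coeff d (initialPart (weights 1) (expansion (p ^ e) C φ)) ≠ 0 ↔
      d 0 + d 1 = C.order.toNat ∧ ¬ (∀ i, p ^ e ∣ d i) ∧
        (Polynomial.taylor (PowerSeries.coeff 1 φ) (degForm C C.order.toNat)).coeff (d 1) ≠ 0 := by
  rw [coeff_initialPart_ne_zero_iff, ← wFlag, wFlag_one_eq p e hC hclean φ h0, weight_weights_one]
  constructor
  · rintro ⟨hne, hdeg⟩
    have hdeg' : d 0 + d 1 = C.order.toNat := by exact_mod_cast hdeg
    rw [expansion, coeff_cleanSeries] at hne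
    split_ifs at hne with hdvd
    · exact absurd rfl hne
    · rw [coeff_subst_shift_of_degree_le φ h0 d hdeg'.le, if_pos hdeg'] at hne
      exact ⟨hdeg', hdvd, hne⟩
  · rintro ⟨hdeg, hdvd, hne⟩
    refine ⟨?_, by exact_mod_cast hdeg⟩
    rw [expansion, coeff_cleanSeries, if_neg hdvd, coeff_subst_shift_of_degree_le φ h0 d hdeg.le, if_pos hdeg]
    exact hne

/-- ONLY THE LINEAR PART OF A TANGENCY-ONE SHIFT MATTERS: `dcurv q C φ 1 = dcurv q C φ' 1` and `dFlag q C φ 1 = dFlag q C φ' 1` whenever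
`[X]φ = [X]φ'`. -/
theorem dcurv_one_congr (p : ℕ) [Fact p.Prime] [CharP k p] (e : ℕ) {C : MvPowerSeries (Fin 2) k} (hC : C ≠ 0)
    (hclean : cleanSeries (p ^ e) C = C) {φ φ' : PowerSeries k} (h0 : PowerSeries.constantCoeff φ = 0)
    (h0' : PowerSeries.constantCoeff φ' = 0) (h1 : PowerSeries.coeff 1 φ = PowerSeries.coeff 1 φ') :
    dcurv (p ^ e) C φ 1 = dcurv (p ^ e) C φ' 1 ∧ dFlag (p ^ e) C φ 1 = dFlag (p ^ e) C φ' 1 := by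
  have hdc : dcurv (p ^ e) C φ 1 = dcurv (p ^ e) C φ' 1 := by
    unfold dcurv ordAlong
    have hiff : ∀ d, coeff d (initialPart (weights 1) (expansion (p ^ e) C φ)) ≠ 0 ↔
        coeff d (initialPart (weights 1) (expansion (p ^ e) C φ')) ≠ 0 := fun d => by
      rw [coeff_initialPart_expansion_one_ne_zero_iff p e hC hclean φ h0, coeff_initialPart_expansion_one_ne_zero_iff p e hC hclean φ' h0',
        h1]
    exact iInf_congr fun d => by
      show (⨅ (_ : (initialPart (weights 1) (expansion (p ^ e) C φ)) d ≠ 0), (d 1 : ℕ∞)) =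
        ⨅ (_ : (initialPart (weights 1) (expansion (p ^ e) C φ')) d ≠ 0), (d 1 : ℕ∞)
      exact iInf_congr_Prop (hiff d) fun _ => rfl
  refine ⟨hdc, ?_⟩
  unfold dFlag
  rw [hdc, wFlag_one_eq p e hC hclean φ h0, wFlag_one_eq p e hC hclean φ' h0']

/-! ### The linear change between the two presentations -/

/-- The linear shift `t·X`. -/
theorem constantCoeff_linShift (t : k) : PowerSeries.constantCoeff (PowerSeries.C t * PowerSeries.X) = 0 := by
  rw [map_mul, PowerSeries.constantCoeff_X, mul_zero]

/-- `shift (t·X)` is the linear shear `y ↦ y + t x`. -/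
theorem shift_linShift_one (t : k) : shift (PowerSeries.C t * PowerSeries.X) 1 = X 1 + C t * X 0 := by
  rw [shift_one, PowerSeries.subst_mul (PowerSeries.HasSubst.X 0), PowerSeries.subst_C, PowerSeries.subst_X (PowerSeries.HasSubst.X 0)]

/-- THE TWO PRESENTATIONS DIFFER BY A LINEAR CHANGE: with `h₁ g₁ = 1`,
`(swap C)(x, y + g₁x) = C(y + g₁x, x)` is `C(x, y + h₁x)` composed with `τ : (x, y) ↦ (y + g₁x, −h₁y)`. -/
theorem subst_tau_shear_eq (C : MvPowerSeries (Fin 2) k) {h₁ g₁ : k} (hinv : h₁ * g₁ = 1) :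
    subst (![X 1 + MvPowerSeries.C g₁ * X 0, MvPowerSeries.C (-h₁) * X 1] : Fin 2 → MvPowerSeries (Fin 2) k)
        (subst (shift (PowerSeries.C h₁ * PowerSeries.X)) C) =
      subst (shift (PowerSeries.C g₁ * PowerSeries.X)) (swap C) := by
  have hτ : HasSubst (![X 1 + MvPowerSeries.C g₁ * X 0, MvPowerSeries.C (-h₁) * X 1] : Fin 2 → MvPowerSeries (Fin 2) k) :=
    hasSubst_of_constantCoeff_zero fun i => by fin_cases i <;> simp [constantCoeff_X]
  have hsh := hasSubst_shift' (k := k) (PowerSeries.C h₁ * PowerSeries.X) (constantCoeff_linShift h₁)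
  rw [subst_shift_swap _ (constantCoeff_linShift g₁), subst_comp_subst_apply hsh hτ]
  congr 1
  funext i
  rcases letter_cases i with rfl | rfl
  · rw [shift_zero, subst_X hτ, shiftSwap, Equiv.swap_apply_left, shift_linShift_one]
    rfl
  · rw [shift_linShift_one, ← coe_substAlgHom hτ, map_add, map_mul, coe_substAlgHom, subst_X hτ, subst_X hτ, subst_C,
      shiftSwap, Equiv.swap_apply_right, shift_zero]
    show MvPowerSeries.C (-h₁) * X 1 + MvPowerSeries.C h₁ * (X 1 + MvPowerSeries.C g₁ * X 0) = X 0
    have : MvPowerSeries.C h₁ * MvPowerSeries.C g₁ = (1 : MvPowerSeries (Fin 2) k) := by rw [← map_mul, hinv, map_one]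
    rw [map_neg]
    linear_combination (X 0 : MvPowerSeries (Fin 2) k) * this

/-- The `τ`-image of a monomial: homogeneous of the same degree, divisible by `y^{d 1}`. -/
theorem coeff_subst_tau_monomial_eq_zero (h₁ g₁ : k) (d d' : Fin 2 →₀ ℕ) (hdd' : d' 0 + d' 1 < d 0 + d 1 ∨ d' 1 < d 1) :
    coeff d' (d.prod fun s n =>
      ((![X 1 + MvPowerSeries.C g₁ * X 0, MvPowerSeries.C (-h₁) * X 1] : Fin 2 → MvPowerSeries (Fin 2) k) s) ^ n) = 0 := by
  rw [Finsupp.prod_fintype _ _ (fun i => pow_zero _), Fin.prod_univ_two]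
  simp only [Matrix.cons_val_zero, Matrix.cons_val_one]
  rcases hdd' with hlt | hlt
  · -- degree
    apply coeff_of_lt_order
    refine lt_of_lt_of_le ?_ le_order_mul
    have h0 : (d 0 : ℕ∞) ≤ ((X 1 + MvPowerSeries.C g₁ * X 0 : MvPowerSeries (Fin 2) k) ^ d 0).order := by
      refine le_trans ?_ (le_order_pow_of_constantCoeff_eq_zero _ (by simp [constantCoeff_X]))
      simp
    have h1 : (d 1 : ℕ∞) ≤ ((MvPowerSeries.C (-h₁) * X 1 : MvPowerSeries (Fin 2) k) ^ d 1).order := by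
      refine le_trans ?_ (le_order_pow_of_constantCoeff_eq_zero _ (by simp [constantCoeff_X]))
      simp
    refine lt_of_lt_of_le ?_ (add_le_add h0 h1)
    rw [Finsupp.degree_eq_sum, Fin.sum_univ_two]
    exact_mod_cast hlt
  · -- divisibility by `y^{d 1}`
    have hdvd : (X 1 : MvPowerSeries (Fin 2) k) ^ d 1 ∣
        (X 1 + MvPowerSeries.C g₁ * X 0) ^ d 0 * (MvPowerSeries.C (-h₁) * X 1) ^ d 1 := by
      rw [mul_pow]
      exact Dvd.dvd.mul_left (Dvd.intro_left _ rfl) _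
    exact (X_pow_dvd_iff.mp hdvd) d' hlt

/-- The `τ`-image of a monomial in `q·ℕ²` is a `q`-th power, hence supported on `q·ℕ²`. -/
theorem coeff_subst_tau_monomial_eq_zero_of_dvd (p : ℕ) [Fact p.Prime] [CharP k p] (e : ℕ) (h₁ g₁ : k)
    (d d' : Fin 2 →₀ ℕ) (hd : ∀ i, p ^ e ∣ d i) (hd' : ¬ ∀ i, p ^ e ∣ d' i) :
    coeff d' (d.prod fun s n =>
      ((![X 1 + MvPowerSeries.C g₁ * X 0, MvPowerSeries.C (-h₁) * X 1] : Fin 2 → MvPowerSeries (Fin 2) k) s) ^ n) = 0 := by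
  obtain ⟨a, ha⟩ := hd 0
  obtain ⟨b, hb⟩ := hd 1
  rw [Finsupp.prod_fintype _ _ (fun i => pow_zero _), Fin.prod_univ_two]
  simp only [Matrix.cons_val_zero, Matrix.cons_val_one]
  rw [ha, hb, mul_comm (p ^ e) a, mul_comm (p ^ e) b, pow_mul, pow_mul, ← mul_pow]
  push Not at hd'
  obtain ⟨i, hi⟩ := hd'
  exact coeff_pow_eq_zero_of_not_dvd p e _ hi

/-! ### The `y`-order of the cleaned degree-`m` form does not go down -/

/-- **THE TRANSVERSAL FLAG READ IN THE OTHER ORIENTATION**: for linear shifts with inverse slopes,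
`dcurv q C (h₁X) 1 ≤ dcurv q (swap C) (g₁X) 1`. -/
theorem dcurv_one_le_swap (p : ℕ) [Fact p.Prime] [CharP k p] (e : ℕ) {C : MvPowerSeries (Fin 2) k} (hC : C ≠ 0)
    (hclean : cleanSeries (p ^ e) C = C) {h₁ g₁ : k} (hinv : h₁ * g₁ = 1) :
    dcurv (p ^ e) C (PowerSeries.C h₁ * PowerSeries.X) 1 ≤ dcurv (p ^ e) (swap C) (PowerSeries.C g₁ * PowerSeries.X) 1 := by
  classical
  set q := p ^ e with hq
  set m := C.order.toNat with hm
  set hX : PowerSeries k := PowerSeries.C h₁ * PowerSeries.X with hhX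
  set gX : PowerSeries k := PowerSeries.C g₁ * PowerSeries.X with hgX
  set τ : Fin 2 → MvPowerSeries (Fin 2) k := ![X 1 + MvPowerSeries.C g₁ * X 0, MvPowerSeries.C (-h₁) * X 1] with hτdef
  have hτ : HasSubst τ := hasSubst_of_constantCoeff_zero fun i => by rw [hτdef]; fin_cases i <;> simp [constantCoeff_X]
  set H₁ := subst (shift hX) C with hH₁
  set H₂ := subst (shift gX) (swap C) with hH₂
  have hH₂eq : H₂ = subst τ H₁ := (subst_tau_shear_eq C hinv).symm
  have hsw : swap C ≠ 0 := swap_ne_zero hC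
  have hswclean : cleanSeries q (swap C) = swap C := by rw [cleanSeries_swap, hclean]
  have hmsw : (swap C).order.toNat = m := by rw [order_swap]
  -- `j₀ = dcurv₁`
  have hfin : dcurv q C hX 1 ≠ ⊤ :=
    ne_top_of_le_ne_top (ENat.coe_ne_top _) (dcurv_le_order p e hC hclean hX (constantCoeff_linShift h₁) le_rfl)
  obtain ⟨j₀, hj₀⟩ := ENat.ne_top_iff_exists.mp hfin
  rw [← hj₀]
  -- the property P: below `j₀`, degree-`m` monomials of `H₁` are in `q·ℕ²`
  have hP : ∀ d : Fin 2 →₀ ℕ, d 0 + d 1 = m → d 1 < j₀ → coeff d H₁ ≠ 0 → ∀ i, q ∣ d i := by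
    intro d hdeg hlt hne
    by_contra hndvd
    have hinit : coeff d (initialPart (weights 1) (expansion q C hX)) ≠ 0 := by
      rw [coeff_initialPart_expansion_one_ne_zero_iff p e hC hclean hX (constantCoeff_linShift h₁)]
      refine ⟨hdeg, hndvd, ?_⟩
      rw [hH₁, coeff_subst_shift_of_degree_le hX (constantCoeff_linShift h₁) d hdeg.le, if_pos hdeg] at hne
      exact hne
    have := ordAlong_le (1 : Fin 2) hinit
    change dcurv q C hX 1 ≤ _ at this
    rw [← hj₀] at this
    exact absurd (by exact_mod_cast this : j₀ ≤ d 1) (not_le.mpr hlt)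
  -- decomposition `H₁ = L + R`
  set ex : ℕ → Fin 2 →₀ ℕ := fun j => Finsupp.single 0 (m - j) + Finsupp.single 1 j with hex
  have hex0 : ∀ j, ex j 0 = m - j := fun j => by simp [hex]
  have hex1 : ∀ j, ex j 1 = j := fun j => by simp [hex]
  set S : Finset ℕ := (Finset.range (m + 1)).filter (fun j => j < j₀) with hS
  set L : MvPowerSeries (Fin 2) k := ∑ j ∈ S, coeff (ex j) H₁ • monomial (ex j) (1 : k) with hL
  have hcoeffL : ∀ d : Fin 2 →₀ ℕ, coeff d L = if d 0 + d 1 = m ∧ d 1 < j₀ then coeff d H₁ else 0 := by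
    intro d
    rw [hL, map_sum]
    simp only [map_smul, coeff_monomial, smul_eq_mul, mul_ite, mul_one, mul_zero]
    split_ifs with hcond
    · rw [Finset.sum_eq_single (d 1)]
      · have : ex (d 1) = d := by
          ext i
          rcases letter_cases i with rfl | rfl
          · rw [hex0]; omega
          · rw [hex1]
        rw [if_pos this.symm, this]
      · intro j _ hj
        rw [if_neg]
        intro hdj
        apply hj
        rw [hdj, hex1]
      · intro hnot
        exfalso; apply hnot
        rw [hS, Finset.mem_filter, Finset.mem_range]
        exact ⟨by omega, hcond.2⟩
    · refine Finset.sum_eq_zero fun j hj => ?_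
      rw [if_neg]
      intro hdj
      apply hcond
      rw [hS, Finset.mem_filter, Finset.mem_range] at hj
      rw [hdj, hex0, hex1]
      exact ⟨by omega, hj.2⟩
  set R := H₁ - L with hR
  have hcoeffR : ∀ d : Fin 2 →₀ ℕ, coeff d R ≠ 0 → m < d 0 + d 1 ∨ (d 0 + d 1 = m ∧ j₀ ≤ d 1) := by
    intro d hd
    rw [hR, map_sub, hcoeffL] at hd
    by_cases hdeg : d 0 + d 1 = m
    · by_cases hlt : d 1 < j₀
      · rw [if_pos ⟨hdeg, hlt⟩, sub_self] at hd; exact absurd rfl hd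
      · exact Or.inr ⟨hdeg, not_lt.mp hlt⟩
    · rw [if_neg (fun h => hdeg h.1), sub_zero] at hd
      have hge : m ≤ d 0 + d 1 := by
        have := order_toNat_le_degree hd
        have hord : C.order ≤ H₁.order := order_le_order_subst _ (constantCoeff_shift hX (constantCoeff_linShift h₁)) C
        have hH₁ne : H₁ ≠ 0 := fun h0 => hd (by rw [h0, map_zero])
        have hfinH : H₁.order ≠ ⊤ := fun hh => hH₁ne (order_eq_top_iff.mp hh)
        have hfinC : C.order ≠ ⊤ := fun hh => hC (order_eq_top_iff.mp hh)
        have : C.order.toNat ≤ H₁.order.toNat := by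
          rw [← ENat.coe_toNat hfinH, ← ENat.coe_toNat hfinC] at hord; exact_mod_cast hord
        omega
      exact Or.inl (by omega)
  -- the degree-`m` monomials of `H₂` below `j₀` are in `q·ℕ²`
  have hprod : ∀ (c : k) (d d' : Fin 2 →₀ ℕ), coeff d' (subst τ (c • monomial d (1 : k))) =
      c * coeff d' (d.prod fun s n => (τ s) ^ n) := by
    intro c d d'
    rw [subst_smul hτ, subst_monomial hτ, map_one, one_mul, map_smul, smul_eq_mul]
  have hQ : ∀ d' : Fin 2 →₀ ℕ, d' 0 + d' 1 = m → d' 1 < j₀ → ¬ (∀ i, q ∣ d' i) → coeff d' H₂ = 0 := by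
    intro d' hdeg' hlt' hnd'
    have hsplit : H₁ = L + R := by rw [hR]; ring
    rw [hH₂eq, hsplit, subst_add hτ, map_add]
    have hL0 : coeff d' (subst τ L) = 0 := by
      rw [hL, ← coe_substAlgHom hτ, map_sum, map_sum]
      refine Finset.sum_eq_zero fun j hj => ?_
      rw [coe_substAlgHom, hprod]
      by_cases hcj : coeff (ex j) H₁ = 0
      · rw [hcj, zero_mul]
      · have hjm : ex j 0 + ex j 1 = m := by
          rw [hex0, hex1]; rw [hS, Finset.mem_filter, Finset.mem_range] at hj; omega
        have hjlt : ex j 1 < j₀ := by rw [hex1]; rw [hS, Finset.mem_filter] at hj; exact hj.2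
        rw [hτdef, coeff_subst_tau_monomial_eq_zero_of_dvd p e h₁ g₁ (ex j) d' (hP (ex j) hjm hjlt hcj) hnd', mul_zero]
    have hR0 : coeff d' (subst τ R) = 0 := by
      rw [coeff_subst hτ R d', finsum_eq_zero_of_forall_eq_zero]
      intro d
      by_cases hdR : coeff d R = 0
      · rw [hdR, zero_smul]
      · rcases hcoeffR d hdR with hgt | ⟨hdeg, hge⟩
        · rw [hτdef, coeff_subst_tau_monomial_eq_zero h₁ g₁ d d' (Or.inl (by omega)), smul_zero]
        · rw [hτdef, coeff_subst_tau_monomial_eq_zero h₁ g₁ d d' (Or.inr (by omega)), smul_zero]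
    rw [hL0, hR0, add_zero]
  -- conclusion: every monomial of the initial part of the second expansion has `y`-exponent `≥ j₀`
  refine le_ordAlong (1 : Fin 2) fun d' hd' => ?_
  rw [coeff_initialPart_expansion_one_ne_zero_iff p e hsw hswclean gX (constantCoeff_linShift g₁), hmsw] at hd'
  obtain ⟨hdeg', hnd', hne'⟩ := hd'
  have hcoeff : coeff d' H₂ ≠ 0 := by
    rw [hH₂, coeff_subst_shift_of_degree_le gX (constantCoeff_linShift g₁) d' (by rw [hmsw]; exact hdeg'.le), hmsw,
      if_pos hdeg']
    exact hne'
  by_contra hlt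
  push Not at hlt
  exact hcoeff (hQ d' hdeg' (by exact_mod_cast hlt) hnd')

/-- THE TWO PRESENTATIONS OF A TRANSVERSAL FLAG HAVE THE SAME `d_𝓕` (linear shifts with inverse slopes). -/
theorem dFlag_one_swap_eq (p : ℕ) [Fact p.Prime] [CharP k p] (e : ℕ) {C : MvPowerSeries (Fin 2) k} (hC : C ≠ 0)
    (hclean : cleanSeries (p ^ e) C = C) {h₁ g₁ : k} (hinv : h₁ * g₁ = 1) :
    dFlag (p ^ e) (swap C) (PowerSeries.C g₁ * PowerSeries.X) 1 = dFlag (p ^ e) C (PowerSeries.C h₁ * PowerSeries.X) 1 := by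
  have hsw : swap C ≠ 0 := swap_ne_zero hC
  have hswclean : cleanSeries (p ^ e) (swap C) = swap C := by rw [cleanSeries_swap, hclean]
  have hle := dcurv_one_le_swap p e hC hclean hinv
  have hge := dcurv_one_le_swap p e hsw hswclean (by rw [mul_comm]; exact hinv : g₁ * h₁ = 1)
  rw [swap_swap] at hge
  have hdc : dcurv (p ^ e) (swap C) (PowerSeries.C g₁ * PowerSeries.X) 1 = dcurv (p ^ e) C (PowerSeries.C h₁ * PowerSeries.X) 1 :=
    le_antisymm hge hle
  unfold dFlag
  rw [hdc, wFlag_one_eq p e hC hclean _ (constantCoeff_linShift h₁), wFlag_one_eq p e hsw hswclean _ (constantCoeff_linShift g₁),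
    order_swap]

/-- **THE TRANSVERSAL FLAG IN THE OTHER ORIENTATION HAS THE SAME TRIPLE.**  Both coordinate lines exceptional (`0, 1 ∈ E`), `C` clean
and non-zero, `g(0) = 0` of tangency `1` with `[X]g = g₁`: the orientation-`true` datum `g` of `(C, E)` has the triple of the
orientation-`false` datum `g₁⁻¹·X`. [HP24 §5 p. 784 ("independent of the choice of a regular system of parameters … subordinate to 𝓕")] -/
theorem flagTriple_swap_of_tangency_one (p : ℕ) [Fact p.Prime] [CharP k p] (e : ℕ) {C : MvPowerSeries (Fin 2) k} (hC : C ≠ 0)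
    (hclean : cleanSeries (p ^ e) C = C) {E : Finset (Fin 2)} (h0E : (0 : Fin 2) ∈ E) (h1E : (1 : Fin 2) ∈ E)
    {g : PowerSeries k} (hg0 : PowerSeries.constantCoeff g = 0) (hg1 : tangency g = 1) :
    flagTriple (p ^ e) (swap C) (swapE E) g =
      flagTriple (p ^ e) C E (PowerSeries.C (PowerSeries.coeff 1 g)⁻¹ * PowerSeries.X) ∧
    IsTangent E (PowerSeries.C (PowerSeries.coeff 1 g)⁻¹ * PowerSeries.X) := by
  set g₁ := PowerSeries.coeff 1 g with hg₁
  have hgne : g ≠ 0 := by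
    intro h; rw [h, tangency, PowerSeries.order_zero] at hg1; simp at hg1
  have hg₁ne : g₁ ≠ 0 := by
    have h := PowerSeries.coeff_order hgne
    rw [show g.order.toNat = 1 from hg1] at h
    exact h
  set hX : PowerSeries k := PowerSeries.C g₁⁻¹ * PowerSeries.X with hhX
  have hhX0 : PowerSeries.constantCoeff hX = 0 := constantCoeff_linShift _
  have hhXne : hX ≠ 0 := by
    intro h
    have := congrArg (PowerSeries.coeff 1) h
    rw [hhX, PowerSeries.coeff_C_mul, PowerSeries.coeff_one_X, mul_one, map_zero] at this
    exact inv_ne_zero hg₁ne this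
  have hhX1 : tangency hX = 1 := by
    unfold tangency
    have : hX.order = ((1 : ℕ) : ℕ∞) := by
      rw [PowerSeries.order_eq_nat]
      refine ⟨?_, fun i hi => ?_⟩
      · rw [hhX, PowerSeries.coeff_C_mul, PowerSeries.coeff_one_X, mul_one]; exact inv_ne_zero hg₁ne
      · have hi0 : i = 0 := by omega
        rw [hi0, PowerSeries.coeff_zero_eq_constantCoeff, hhX0]
    rw [this, ENat.toNat_coe]
  have h1sw : (1 : Fin 2) ∈ swapE E := by rw [mem_swapE, Equiv.swap_apply_right]; exact h0E
  have h0sw : (0 : Fin 2) ∈ swapE E := by rw [mem_swapE, Equiv.swap_apply_left]; exact h1E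
  have htg : IsTangent (swapE E) g := ⟨h1sw, hgne, Or.inr h0sw⟩
  have hth : IsTangent E hX := ⟨h1E, hhXne, Or.inr h0E⟩
  refine ⟨?_, hth⟩
  rw [flagTriple_of_not_isN0 _ _ htg.not_isN0, flagTriple_of_not_isN0 _ _ hth.not_isN0, hg1, hhX1]
  congr 2
  -- `dFlag` agrees: reduce `g` to its linear part, then swap
  have hsw : swap C ≠ 0 := swap_ne_zero hC
  have hswclean : cleanSeries (p ^ e) (swap C) = swap C := by rw [cleanSeries_swap, hclean]
  have hlin := (dcurv_one_congr p e hsw hswclean hg0 (constantCoeff_linShift g₁)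
    (by rw [PowerSeries.coeff_C_mul, PowerSeries.coeff_one_X, mul_one])).2
  rw [hlin]
  exact dFlag_one_swap_eq p e hC hclean (inv_mul_cancel₀ hg₁ne)

end PurePowerFlag

end Summit.ResolutionOfSingularities.ResolutionOfSingularities.Theorems
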